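import Mathlib
import Summits.KontsevichZagierPeriods.Zeta5Search.Families.CubicalChartCT
import HarnessLib

/-!
# ζ(5) search — Families: coefficient extraction in the cubical chart, ANY number of gaps

HONEST FRAMING: systematic search; no irrationality claim unless certified.  Cell `pub-zeta5`, certifier 2 (cert-2 g10,
2026-08-22).  An identity between integer coefficients of polynomials / power series; nothing about `ζ(5)`; no number of
record moves.

WHAT.  The general-`N` form of `Families/CubicalChartCT` (which is the case `N = 5`, six gaps, written first and kept as the
dependency of `Families/CubicalChartLeadPi8v`): `N + 1` consecutive gaps `g₀,…,g_N` of `N + 2` real points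
`0 = p₀ < p₁ < ⋯ < p_{N+1} = 1`, cubical chart `p_k = x_k ⋯ x_N` (variable `i : Fin N` is `x_{i+1}`), `g₀ = x₁⋯x_N`,
`g_w = x_{w+1}⋯x_N (1 − x_w)`.  THEOREM (`CubicalChartN.coeff_chart`): for `B ∈ ℕ^{N+1}` and `P ∈ ℤ[g]` homogeneous of degree
`|B|`,

  `[g^B] P = [x^{M(B)}] ( P(g(x)) · ∏_{w=1}^{N} (1 − x_w)^{−(B_w+1)} )`,   `M(B)_k = B₀ + ⋯ + B_{k−1}`.

The proof is that of the six-gap file with the one-variable bookkeeping (`prod_coeffPow_eq_zero`) done by induction along the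
gaps instead of by enumeration: if all `N` factors `[x_k^{d_k}](1−x_k)^{m_k − 1}` (`m = β − B`, `d_k = −(m₀+⋯+m_k)`) are
non-zero then every `m_w ≤ 0`, hence `m = 0`.  Target use: the `N = 7` (eight gaps, `M_{0,10}`) leading coefficients of Brown's
generalised cellular family "vanishing in the middle" (`Cells/VanishingMiddleLeading.leading`, fam-brown9).  Standard axioms only.
-/

noncomputable section

open MvPowerSeries Finset

namespace Summit.KontsevichZagierPeriods.Zeta5Search.Families.Cellular

namespace CubicalChartN

open Summit.KontsevichZagierPeriods.Zeta5Search.Brown8 (coeffPow)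
open CubicalChart (coeffPow_of_idx_neg coeffPow_nat_nat coeffPow_negSucc_nat coeffPow_zero_idx coeffPow_eq_zero_of_lt
  coeffPow_succ)

variable {N : ℕ}

/-! ## The power-series ring and the series `U(e) = ∏_i (1 − x_i)^{e_i}`, `e ∈ ℤ^N` -/

/-- `ℤ[[x₁,…,x_N]]` (variable `i : Fin N` is `x_{i+1}`). -/
abbrev T (N : ℕ) := MvPowerSeries (Fin N) ℤ

/-- The variable `x_{i+1}`. -/
abbrev x (i : Fin N) : T N := MvPowerSeries.X i

/-- **`U(e) = ∏_{i} (1 − x_i)^{e_i}`** for an INTEGER exponent vector, defined by its coefficients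
`[x^d] U(e) = ∏_i coeffPow e_i d_i`. -/
def U (e : Fin N → ℤ) : T N := fun d => ∏ i, coeffPow (e i) (d i)

/-- The coefficients of `U(e)`. -/
@[simp] theorem coeff_U (e : Fin N → ℤ) (d : Fin N →₀ ℕ) : coeff d (U e) = ∏ i, coeffPow (e i) (d i) := rfl

/-- **`U(e) · (1 − x_j) = U(e + δ_j)`**. -/
theorem U_mul_oneSub (e : Fin N → ℤ) (j : Fin N) : U e * (1 - x j) = U (e + Pi.single j 1) := by
  classical
  ext d
  rw [mul_sub, mul_one, map_sub, coeff_U, coeff_U,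
    show (x j : T N) = monomial (Finsupp.single j 1) 1 from MvPowerSeries.X_def j, coeff_mul_monomial]
  rw [← Finset.mul_prod_erase _ _ (Finset.mem_univ j), ← Finset.mul_prod_erase _ _ (Finset.mem_univ j)]
  have hrest : ∏ i ∈ Finset.univ.erase j, coeffPow ((e + Pi.single j 1 : Fin N → ℤ) i) (d i) =
      ∏ i ∈ Finset.univ.erase j, coeffPow (e i) (d i) := by
    refine Finset.prod_congr rfl fun i hi => ?_
    rw [Finset.mem_erase] at hi
    simp [hi.1]
  rw [hrest]
  simp only [Pi.add_apply, Pi.single_eq_same]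
  rw [coeffPow_succ]
  by_cases hk : 1 ≤ d j
  · have hle : Finsupp.single j 1 ≤ d := by rw [Finsupp.single_le_iff]; exact hk
    rw [if_pos hk, if_pos hle, mul_one, coeff_U,
      ← Finset.mul_prod_erase _ _ (Finset.mem_univ j)]
    have hrest' : ∏ i ∈ Finset.univ.erase j, coeffPow (e i) ((d - Finsupp.single j 1 : Fin N →₀ ℕ) i) =
        ∏ i ∈ Finset.univ.erase j, coeffPow (e i) (d i) := by
      refine Finset.prod_congr rfl fun i hi => ?_
      rw [Finset.mem_erase] at hi
      simp [Ne.symm hi.1]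
    rw [hrest']
    have hj : (((d - Finsupp.single j 1 : Fin N →₀ ℕ) j : ℕ) : ℤ) = (d j : ℤ) - 1 := by
      simp only [Finsupp.coe_tsub, Pi.sub_apply, Finsupp.single_eq_same]
      omega
    rw [hj]; ring
  · have hle : ¬ Finsupp.single j 1 ≤ d := by rw [Finsupp.single_le_iff]; exact hk
    rw [if_neg hk, if_neg hle]; ring

/-- `U(e) · (1 − x_j)^n = U(e + n δ_j)`. -/
theorem U_mul_oneSub_pow (e : Fin N → ℤ) (j : Fin N) (n : ℕ) :
    U e * (1 - x j) ^ n = U (e + Pi.single j (n : ℤ)) := by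
  induction n generalizing e with
  | zero => simp
  | succ n ih =>
    rw [pow_succ, ← mul_assoc, ih, U_mul_oneSub]
    congr 1
    ext i
    by_cases hi : i = j
    · subst hi; simp; ring
    · simp [hi]

/-- `U(e) · ∏_j (1 − x_j)^{n_j} = U(e + n)`. -/
theorem U_mul_prod (e : Fin N → ℤ) (n : Fin N → ℕ) :
    U e * ∏ j, (1 - x j) ^ n j = U (fun i => e i + n i) := by
  classical
  have key : ∀ s : Finset (Fin N), U e * ∏ j ∈ s, (1 - x j) ^ n j =
      U (fun i => e i + if i ∈ s then (n i : ℤ) else 0) := by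
    intro s
    induction s using Finset.induction_on with
    | empty => simp
    | @insert j s hj ih =>
      rw [Finset.prod_insert hj, mul_comm ((1 - x j) ^ n j) _, ← mul_assoc, ih, U_mul_oneSub_pow]
      congr 1
      ext i
      by_cases hi : i = j
      · subst hi; simp [hj]
      · simp [hi, Finset.mem_insert]
  simpa using key Finset.univ

/-! ## The chart -/

/-- Exponent vector of `x_w ⋯ x_N` (`w : Fin (N+1)`): entry `k` is `[w ≤ k]` (variable `k : Fin N` being `x_{k+1}`). -/
def tail (w : Fin (N + 1)) : Fin N →₀ ℕ :=
  Finsupp.equivFunOnFinite.symm fun k => if w.val ≤ k.val then 1 else 0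

/-- The entries of `tail`. -/
@[simp] theorem tail_apply (w : Fin (N + 1)) (k : Fin N) : tail w k = if w.val ≤ k.val then 1 else 0 := by
  simp [tail]

/-- The unit factor of the gap `g_w`: `1` for `w = 0`, `1 − x_w` for `w ≥ 1` (variable `w − 1`). -/
def unitFac (w : Fin (N + 1)) : T N := Fin.cases 1 (fun j => 1 - x j) w

/-- `unitFac 0 = 1`. -/
@[simp] theorem unitFac_zero : unitFac (0 : Fin (N + 1)) = 1 := rfl
/-- `unitFac (j+1) = 1 − x_j`. -/
@[simp] theorem unitFac_succ (j : Fin N) : unitFac j.succ = 1 - x j := rfl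

/-- **The cubical chart** `g_w ↦ x_w⋯x_N · (1 − x_{w−1})`. -/
def gChart (w : Fin (N + 1)) : T N := monomial (tail w) 1 * unitFac w

/-- The chart as a ring homomorphism `ℤ[g₀,…,g_N] → ℤ[[x₁,…,x_N]]`. -/
def chart : MvPolynomial (Fin (N + 1)) ℤ →ₐ[ℤ] T N := MvPolynomial.aeval gChart

/-- `chart (g_w) = gChart w`. -/
@[simp] theorem chart_X (w : Fin (N + 1)) : chart (MvPolynomial.X w) = (gChart w : T N) := by
  simp [chart]

/-- The monomial exponent `M(β) = Σ_w β_w · tail w`. -/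
def Mexp (β : Fin (N + 1) →₀ ℕ) : Fin N →₀ ℕ := ∑ w, β w • tail w

/-- The entries of `M(β)`. -/
theorem Mexp_apply (β : Fin (N + 1) →₀ ℕ) (k : Fin N) :
    Mexp β k = ∑ w : Fin (N + 1), if w.val ≤ k.val then β w else 0 := by
  simp only [Mexp, Finsupp.coe_finsetSum, Finset.sum_apply, Finsupp.coe_smul, Pi.smul_apply, tail_apply,
    smul_eq_mul]
  refine Finset.sum_congr rfl fun w _ => ?_
  split_ifs <;> simp

/-- **Image of a monomial**: `chart (g^β) = x^{M(β)} · ∏_{j} (1 − x_j)^{β_{j+1}}`. -/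
theorem chart_monomial (β : Fin (N + 1) →₀ ℕ) :
    chart (MvPolynomial.monomial β 1) = (monomial (Mexp β) 1 : T N) * ∏ j : Fin N, (1 - x j) ^ β j.succ := by
  classical
  rw [chart, MvPolynomial.aeval_monomial, map_one, one_mul, Finsupp.prod_fintype _ _ (fun i => by simp)]
  simp only [gChart, mul_pow, Finset.prod_mul_distrib, monomial_pow, one_pow]
  have h1 : ∏ w : Fin (N + 1), (monomial (β w • tail w)) (1 : ℤ) = (monomial (Mexp β) 1 : T N) := by
    rw [prod_monomial, Finset.prod_const_one]; rfl
  have h2 : ∏ w : Fin (N + 1), unitFac w ^ β w = ∏ j : Fin N, (1 - x j) ^ β j.succ := by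
    rw [Fin.prod_univ_succ]; simp
  rw [h1, h2]

/-! ## The one-variable bookkeeping, by induction along the gaps -/

/-- For `m ∈ ℤ^{N+1}` with `Σ m = 0`, if every factor `[x_k^{d_k}](1−x_k)^{m_{k+1} − 1}` with `d_k = −(m₀+⋯+m_k) ≥ 0` is non-zero
then `m = 0`; contrapositively the product vanishes for `m ≠ 0`. -/
theorem prod_coeffPow_eq_zero (m : Fin (N + 1) → ℤ) (d : Fin N → ℕ) (hsum : ∑ w, m w = 0)
    (hd : ∀ k : Fin N, (d k : ℤ) = -∑ w : Fin (N + 1), if w.val ≤ k.val then m w else 0) (hm : m ≠ 0) :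
    ∏ k : Fin N, coeffPow (m k.succ - 1) (d k) = 0 := by
  by_contra hne
  have hfac : ∀ k : Fin N, m k.succ ≤ 0 ∨ (d k : ℤ) ≤ m k.succ - 1 := by
    intro k
    by_contra h
    push Not at h
    exact hne (Finset.prod_eq_zero (Finset.mem_univ k) (coeffPow_eq_zero_of_lt _ _ (by omega) (by omega)))
  -- partial sums `S k = m₀ + ⋯ + m_k`
  set S : ℕ → ℤ := fun k => ∑ w : Fin (N + 1), if w.val ≤ k then m w else 0 with hS
  have hS0 : S 0 = m 0 := by
    simp only [hS]
    rw [Finset.sum_eq_single (0 : Fin (N + 1))]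
    · simp
    · intro w _ hw
      rw [if_neg]
      intro h
      apply hw
      exact Fin.ext (by simpa using h)
    · simp
  have hSsucc : ∀ k : ℕ, ∀ hk : k + 1 < N + 1, S (k + 1) = S k + m ⟨k + 1, hk⟩ := by
    intro k hk
    simp only [hS]
    have hsplit : ∀ w : Fin (N + 1), (if w.val ≤ k + 1 then m w else 0) =
        (if w.val ≤ k then m w else 0) + (if w = ⟨k + 1, hk⟩ then m w else 0) := by
      intro w
      by_cases h1 : w.val ≤ k
      · have h2 : w ≠ ⟨k + 1, hk⟩ := by
          intro h; rw [h] at h1; simp at h1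
        rw [if_pos (by omega), if_pos h1, if_neg h2, add_zero]
      · by_cases h2 : w = ⟨k + 1, hk⟩
        · subst h2
          simp
        · have h3 : ¬ w.val ≤ k + 1 := by
            intro h
            apply h2
            exact Fin.ext (by simp; omega)
          rw [if_neg h3, if_neg h1, if_neg h2, add_zero]
    rw [Finset.sum_congr rfl fun w _ => hsplit w, Finset.sum_add_distrib, Finset.sum_ite_eq']
    simp
  have hSN : S N = 0 := by
    simp only [hS]
    rw [← hsum]
    refine Finset.sum_congr rfl fun w _ => ?_
    rw [if_pos (by omega)]
  have hdS : ∀ k : Fin N, (d k : ℤ) = -S k.val := fun k => hd k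
  -- every `m w ≤ 0`
  have hle : ∀ w : Fin (N + 1), m w ≤ 0 := by
    intro w
    rcases Fin.eq_zero_or_eq_succ w with rfl | ⟨k, rfl⟩
    · rcases Nat.eq_zero_or_pos N with hN | hN
      · subst hN
        have : S 0 = 0 := hSN
        rw [hS0] at this
        exact this.le
      · have h := hdS ⟨0, hN⟩
        rw [show (⟨0, hN⟩ : Fin N).val = 0 from rfl, hS0] at h
        have : (0 : ℤ) ≤ d ⟨0, hN⟩ := Int.natCast_nonneg _
        omega
    · by_contra hpos
      push Not at hpos
      have h1 : (d k : ℤ) ≤ m k.succ - 1 := (hfac k).resolve_left (by omega)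
      have h3 := hSsucc k.val (by omega)
      have hk : (⟨k.val + 1, by omega⟩ : Fin (N + 1)) = k.succ := Fin.ext (by simp)
      rw [hk] at h3
      have h4 := hdS k
      by_cases hlast : k.val + 1 < N
      · have h2 := hdS ⟨k.val + 1, hlast⟩
        have : (0 : ℤ) ≤ d ⟨k.val + 1, hlast⟩ := Int.natCast_nonneg _
        simp only at h2
        omega
      · have hkN : k.val + 1 = N := by omega
        rw [hkN, hSN] at h3
        omega
  -- hence `m = 0`
  apply hm
  funext w
  exact (Finset.sum_eq_zero_iff_of_nonpos fun w _ => hle w).mp hsum w (Finset.mem_univ w)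

/-- **Coefficient of a monomial image**: for `|β| = |B|`, `[x^{M(B)}] ( chart(g^β) · U(−B'−1) ) = [β = B]`. -/
theorem coeff_chart_monomial (β : Fin (N + 1) →₀ ℕ) (B : Fin (N + 1) → ℕ) (hdeg : ∑ w, β w = ∑ w, B w) :
    coeff (Mexp (Finsupp.equivFunOnFinite.symm B))
        (chart (MvPolynomial.monomial β 1) * U (fun i : Fin N => -(B i.succ : ℤ) - 1)) =
      if β = Finsupp.equivFunOnFinite.symm B then 1 else 0 := by
  classical
  rw [chart_monomial, mul_assoc, mul_comm (∏ j : Fin N, (1 - x j) ^ β j.succ) (U _), U_mul_prod,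
    coeff_monomial_mul]
  by_cases hβ : β = Finsupp.equivFunOnFinite.symm B
  · subst hβ
    rw [if_pos le_rfl, if_pos rfl, tsub_self, one_mul, coeff_U]
    simp [coeffPow_zero_idx]
  · rw [if_neg hβ]
    split_ifs with hle
    · rw [one_mul, coeff_U]
      set m : Fin (N + 1) → ℤ := fun w => (β w : ℤ) - B w with hm
      have hm0 : m ≠ 0 := by
        intro h; apply hβ; ext w
        have := congrArg (fun f => f w) h
        simp only [hm, Pi.zero_apply] at this
        simp only [Finsupp.coe_equivFunOnFinite_symm]; omega
      have hsum : ∑ w, m w = 0 := by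
        simp only [hm, Finset.sum_sub_distrib]
        have : (∑ w, (β w : ℤ)) = ∑ w, (B w : ℤ) := by exact_mod_cast hdeg
        rw [this]; ring
      have hprod : ∏ k : Fin N, coeffPow (-(B k.succ : ℤ) - 1 + (β k.succ : ℕ))
          ((Mexp (Finsupp.equivFunOnFinite.symm B) - Mexp β : Fin N →₀ ℕ) k) =
          ∏ k : Fin N, coeffPow (m k.succ - 1)
            ((fun k => (Mexp (Finsupp.equivFunOnFinite.symm B) - Mexp β : Fin N →₀ ℕ) k) k) := by
        refine Finset.prod_congr rfl fun k _ => ?_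
        congr 1; simp only [hm]; ring
      rw [hprod]
      apply prod_coeffPow_eq_zero m _ hsum _ hm0
      intro k
      have hk := hle k
      simp only [Finsupp.coe_tsub, Pi.sub_apply]
      rw [Int.ofNat_sub hk]
      simp only [Mexp_apply, Finsupp.coe_equivFunOnFinite_symm, hm]
      push_cast
      rw [← Finset.sum_sub_distrib, ← Finset.sum_neg_distrib]
      refine Finset.sum_congr rfl fun w _ => ?_
      split_ifs <;> simp
    · rfl

/-! ## The theorem -/

/-- **Constant-term invariance in the cubical chart, any number of gaps.**  For `B ∈ ℕ^{N+1}` and `P ∈ ℤ[g₀,…,g_N]`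
homogeneous of degree `|B|`: `[g^B] P = [x^{M(B)}] ( chart(P) · ∏_{w=1}^{N} (1 − x_w)^{−(B_w + 1)} )`. -/
theorem coeff_chart (P : MvPolynomial (Fin (N + 1)) ℤ) (B : Fin (N + 1) → ℕ) (hP : P.IsHomogeneous (∑ w, B w)) :
    coeff (Mexp (Finsupp.equivFunOnFinite.symm B)) (chart P * U (fun i : Fin N => -(B i.succ : ℤ) - 1)) =
      MvPolynomial.coeff (Finsupp.equivFunOnFinite.symm B) P := by
  classical
  conv_lhs => rw [P.as_sum]
  rw [map_sum, Finset.sum_mul, map_sum]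
  have hterm : ∀ β ∈ P.support, coeff (Mexp (Finsupp.equivFunOnFinite.symm B))
      (chart (MvPolynomial.monomial β (MvPolynomial.coeff β P)) * U (fun i : Fin N => -(B i.succ : ℤ) - 1)) =
      if β = Finsupp.equivFunOnFinite.symm B then MvPolynomial.coeff β P else 0 := by
    intro β hβ
    have hdeg : ∑ w, β w = ∑ w, B w := by
      by_contra hne
      apply (MvPolynomial.mem_support_iff.mp hβ)
      apply hP.coeff_eq_zero
      rwa [Finsupp.degree_eq_sum]
    have hmono : MvPolynomial.monomial β (MvPolynomial.coeff β P) =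
        MvPolynomial.C (MvPolynomial.coeff β P) * MvPolynomial.monomial β (1 : ℤ) := by
      rw [MvPolynomial.C_mul_monomial, mul_one]
    rw [hmono, map_mul chart, MvPolynomial.algHom_C, MvPowerSeries.algebraMap_apply, Algebra.algebraMap_self,
      RingHom.id_apply, mul_assoc, MvPowerSeries.coeff_C_mul, coeff_chart_monomial β B hdeg]
    split_ifs <;> simp
  rw [Finset.sum_congr rfl hterm, Finset.sum_ite_eq']
  split_ifs with h
  · rfl
  · exact (MvPolynomial.notMem_support_iff.mp h).symm

end CubicalChartN

end Summit.KontsevichZagierPeriods.Zeta5Search.Families.Cellular
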